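import Literature.NumberTheory.EllipticCurves.NeumannSetzerCurves
import Literature.NumberTheory.EllipticCurves.VariableChangePoints
import Literature.NumberTheory.EllipticCurves.Rank1Residual.X11RankOneCertificates.Minimality
import Summits.BirchSwinnertonDyer.BirchSwinnertonDyer.Theorems.EisensteinDepletionAtTwoStarDefs
import HarnessLib

/-!
# Route `EisensteinDepletionAtTwo`, crux E1M `DepletedLambdaLawAtTwoMod` (item stmt-BirchSwinnertonDyer-20341),
# line `star` — prime-level content of the research stub (★-SymbC), part 1: MODELS

Cell `bsd-rank2` (HOME run/shared/lean/pub/bsd-rank2/), seat `bsd-rank2-eng-2` GEN 9. THEOREMS ONLY — no definition,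
no new named fact, no `sorry`. HONEST FRAMING: elementary algebra of Weierstrass models; nothing reads an analytic
rank; (★-SymbC)/(★)/E1M are NOT proved; BSD is not proved by any of this (PARTITION D-0054: none — r_an ≥ 2 axis S0,
door T-r3₂).

WHAT IS PROVED (consumed by `…StarPrimeLevel.lean`, which draws the consequence for the registered stub
`stub_starSymbC : StarSymbC` of `Cruxes/DepletedLambdaLawAtTwoMod/Lines/star.lean` v3.1 — planner p2 GEN 21's hidden
content (H1), memo `p2/g21/serre-dlog.md` §4: at PRIME level the stub asserts that the Prop-5.14 habitat is EMPTY):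

* §1 at a prime level `N` there is NO admissible stabilisation datum (`not_isAdmissibleStabData_of_prime`), so the
  conclusion `∃ β, IsAdmissibleStabData N_W β ∧ …` of (★-SymbC) is unsatisfiable at prime conductor;
* §2 transport of `HasRationalTwoTorsionX` and of Greenberg's `TwoTorsionOdd` along a change of variables (the
  substitution `x = u²x' + r` is order preserving; `u⁶·ψ_{C•W}(x') = ψ_W(u²x' + r)` for the `2`-division cubic);
* §3 the Neumann–Setzer models `E₀(u)`, `E₁(u)` (`N = u² + 64` prime, `u ≡ 3 (mod 4)`): both are GLOBAL MINIMAL models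
  (`Δ = −N²`, `N`); the rational `2`-torsion `x`-coordinates are `u/4` on `E₀(u)` — the ONLY real root of
  `(4x − u)(x² + 4)`, so the point is ODD — and `0` on `E₁(u)` — the MIDDLE real root of `x(4x² − ux − 4)` (the other
  two, `(u ± √N)/8`, are irrational of opposite signs), so the point is NOT odd.

References: W. Stein, M. Watkins, IMRN 2004:27, §1 [SteinWatkins2004]; B. Mazur, Publ. Math. IHÉS 47 (1977), III §7
[Mazur1977]; R. Greenberg, LNM 1716 (1999) §5 [GreenbergLNM1716]; G. Stevens, *Arithmetic on Modular Curves* (1982)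
§2.4–2.5 [Stevens1982]; J. Silverman, GTM 106, III.1, VII.1 [SilvermanAEC2009].
-/

set_option linter.dupNamespace false
set_option autoImplicit false

noncomputable section

open scoped Classical

open WeierstrassCurve Literature.NumberTheory.EllipticCurves Literature.NumberTheory.EllipticCurves.Greenberg1999
  Literature.NumberTheory.EllipticCurves.Rank1Residual.X11RankOneCertificates

namespace Summit.BirchSwinnertonDyer.BirchSwinnertonDyer.Theorems.DepletionAtTwo

/-! ## §1 No admissible stabilisation datum at prime level -/

/-- At a PRIME level `N` there is no admissible stabilisation datum: `N.primeFactors = {N}` with exponent `1`, so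
admissibility would need `β N = N` and `β N = 1` at once. Hence the conclusion of (★-SymbC) is unsatisfiable at prime
conductor. [cite: Stevens1982, §2.4–2.5 (PDF pp. 35–38) (the admissibility conditions)] -/
theorem not_isAdmissibleStabData_of_prime {N : ℕ} (hN : N.Prime) (β : ℕ → ℕ) : ¬ IsAdmissibleStabData N β := by
  rintro ⟨-, -, h⟩
  have hpf : N.primeFactors = {N} := hN.primeFactors
  have hfac : N.factorization N = 1 := hN.factorization_self
  rcases h with ⟨ℓ, hℓ, h2⟩ | ⟨⟨ℓ, hℓ, hβ⟩, ⟨ℓ', hℓ', hβ'⟩⟩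
  · rw [hpf, Finset.mem_singleton] at hℓ
    subst hℓ
    rw [hfac] at h2
    exact absurd h2 (by norm_num)
  · rw [hpf, Finset.mem_singleton] at hℓ hℓ'
    subst hℓ hℓ'
    rw [hβ'] at hβ
    exact hN.one_lt.ne hβ

/-! ## §2 Transport along a change of variables -/

section Transport

variable (W : WeierstrassCurve ℚ) (C : VariableChange ℚ)

/-- A rational point of order `2` with `x`-coordinate `x` on `W` gives one with `x`-coordinate `u⁻²(x − r)` on `C • W`
(`2y' + a₁'x' + a₃' = u⁻³(2y + a₁x + a₃)`). [cite: SilvermanAEC2009, III.1 Table 3.1] -/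
theorem hasRationalTwoTorsionX_smul {x : ℚ} (h : HasRationalTwoTorsionX W x) :
    HasRationalTwoTorsionX (C • W) (C.toX x) := by
  obtain ⟨y, hE, h2⟩ := h
  refine ⟨C.toY x y, (VariableChange.equation_iff W C x y).mpr hE, ?_⟩
  have h := VariableChange.evalEval_polynomialY_toXY W C x y
  rw [Affine.evalEval_polynomialY, Affine.evalEval_polynomialY, h2, mul_zero] at h
  exact h

/-- The real `2`-division cubic transforms under `x = u²x' + r` by the factor `u⁶`:
`u⁶·ψ_{C•W}(x') = ψ_W(u²x' + r)`. [cite: SilvermanAEC2009, III.1 Table 3.1 (b₂', b₄', b₆')] -/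
theorem twoDivisionCubic_smul (ρ : ℝ) :
    ((C.u : ℚ) : ℝ) ^ 6 * (4 * ρ ^ 3 + ((C • W).b₂ : ℝ) * ρ ^ 2 + 2 * ((C • W).b₄ : ℝ) * ρ + ((C • W).b₆ : ℝ)) =
      4 * (((C.u : ℚ) : ℝ) ^ 2 * ρ + (C.r : ℝ)) ^ 3 + (W.b₂ : ℝ) * (((C.u : ℚ) : ℝ) ^ 2 * ρ + (C.r : ℝ)) ^ 2 +
        2 * (W.b₄ : ℝ) * (((C.u : ℚ) : ℝ) ^ 2 * ρ + (C.r : ℝ)) + (W.b₆ : ℝ) := by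
  have hu0 : ((C.u : ℚ) : ℝ) ≠ 0 := by exact_mod_cast C.u.ne_zero
  rw [variableChange_b₂, variableChange_b₄, variableChange_b₆]
  push_cast [Units.val_inv_eq_inv_val]
  field_simp
  ring

/-- `TwoTorsionOdd` is invariant under a change of variables: the substitution `x = u²x' + r` (`u ≠ 0`) is an
order-preserving bijection of `ℝ` carrying the real roots of `ψ_{C•W}` onto those of `ψ_W`.
[cite: GreenbergLNM1716, §5 Remark (chunk p0174) ("the point in E(ℝ)[2] whose x-coordinate is minimal")] -/
theorem twoTorsionOdd_smul_iff (x : ℚ) : TwoTorsionOdd (C • W) (C.toX x) ↔ TwoTorsionOdd W x := by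
  have hu0 : ((C.u : ℚ) : ℝ) ≠ 0 := by exact_mod_cast C.u.ne_zero
  have hu2 : (0 : ℝ) < ((C.u : ℚ) : ℝ) ^ 2 := by positivity
  have hui2 : (0 : ℝ) < (((C.u : ℚ) : ℝ) ^ 2)⁻¹ := by positivity
  have hx : ((C.toX x : ℚ) : ℝ) = (((C.u : ℚ) : ℝ) ^ 2)⁻¹ * ((x : ℝ) - (C.r : ℝ)) := by
    rw [VariableChange.toX_def]; push_cast [Units.val_inv_eq_inv_val]; ring
  constructor
  · -- odd on `C • W` at `x' = u⁻²(x − r)` ⇒ odd on `W` at `x`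
    intro h ρ hρ
    set ρ' : ℝ := (((C.u : ℚ) : ℝ) ^ 2)⁻¹ * (ρ - (C.r : ℝ)) with hρ'
    have hsub : ((C.u : ℚ) : ℝ) ^ 2 * ρ' + (C.r : ℝ) = ρ := by
      rw [hρ']; field_simp; ring
    have hid := twoDivisionCubic_smul W C ρ'
    rw [hsub, hρ] at hid
    have hroot : 4 * ρ' ^ 3 + ((C • W).b₂ : ℝ) * ρ' ^ 2 + 2 * ((C • W).b₄ : ℝ) * ρ' + ((C • W).b₆ : ℝ) = 0 := by
      rcases mul_eq_zero.mp hid with h6 | h6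
      · exact absurd h6 (pow_ne_zero _ hu0)
      · exact h6
    have hle := h ρ' hroot
    rw [hx, hρ'] at hle
    have hle' := mul_le_mul_of_nonneg_left hle hu2.le
    rw [← mul_assoc, ← mul_assoc, mul_inv_cancel₀ (pow_ne_zero _ hu0), one_mul, one_mul] at hle'
    linarith
  · -- odd on `W` at `x` ⇒ odd on `C • W` at `u⁻²(x − r)`
    intro h ρ' hρ'
    have hid := twoDivisionCubic_smul W C ρ'
    rw [hρ', mul_zero] at hid
    have hle := h _ hid.symm
    rw [hx]
    have h1 : (x : ℝ) - (C.r : ℝ) ≤ ((C.u : ℚ) : ℝ) ^ 2 * ρ' := by linarith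
    have h2 := mul_le_mul_of_nonneg_left h1 hui2.le
    rwa [← mul_assoc, inv_mul_cancel₀ (pow_ne_zero _ hu0), one_mul] at h2

/-- Inverse direction on `x`-coordinates: `x = u²·(u⁻²(x − r)) + r`. [cite: SilvermanAEC2009, III.1 Table 3.1] -/
theorem eq_ofX_toX (x : ℚ) : x = (C.u : ℚ) ^ 2 * C.toX x + C.r := by
  have h := C.ofX_toX x
  rw [VariableChange.ofX_def] at h
  exact h.symm

end Transport

/-! ## §3 The Neumann–Setzer models -/

section NeumannSetzer

variable (u : ℤ)

/-- `b₂(E₁(u)) = −u`, `b₄(E₁(u)) = −2`, `b₆(E₁(u)) = 0`. [cite: SteinWatkins2004, §1 eq. (1) (PDF p. 3)] -/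
theorem b_neumannSetzerCurve₁ :
    (neumannSetzerCurve₁ u).b₂ = -(u : ℚ) ∧ (neumannSetzerCurve₁ u).b₄ = -2 ∧ (neumannSetzerCurve₁ u).b₆ = 0 := by
  refine ⟨?_, ?_, ?_⟩ <;>
    simp only [neumannSetzerCurve₁, WeierstrassCurve.b₂, WeierstrassCurve.b₄, WeierstrassCurve.b₆] <;> ring

/-- `b₂(E₀(u)) = −u`, `b₄(E₀(u)) = 8`, `b₆(E₀(u)) = −4u`. [cite: SteinWatkins2004, §1 eq. (1) (PDF p. 3)] -/
theorem b_neumannSetzerCurve₀ :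
    (neumannSetzerCurve₀ u).b₂ = -(u : ℚ) ∧ (neumannSetzerCurve₀ u).b₄ = 8 ∧ (neumannSetzerCurve₀ u).b₆ = -4 * (u : ℚ) := by
  refine ⟨?_, ?_, ?_⟩ <;>
    simp only [neumannSetzerCurve₀, WeierstrassCurve.b₂, WeierstrassCurve.b₄, WeierstrassCurve.b₆] <;> ring

/-- A prime is not the square of a rational number. [folklore] -/
theorem not_sq_eq_prime {N : ℕ} (hN : N.Prime) (q : ℚ) : q ^ 2 ≠ (N : ℚ) := by
  intro h
  have hsq : IsSquare (N : ℚ) := ⟨q, by rw [← h, sq]⟩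
  rw [Rat.isSquare_natCast_iff] at hsq
  obtain ⟨m, hm⟩ := hsq
  have hmd : m ∣ N := ⟨m, hm⟩
  rcases hN.eq_one_or_self_of_dvd m hmd with h1 | h1
  · rw [h1, mul_one] at hm; exact hN.one_lt.ne' hm
  · rw [h1] at hm
    have : N * N = N * 1 := by rw [mul_one]; exact hm.symm
    have h1' := Nat.eq_of_mul_eq_mul_left hN.pos this
    exact hN.one_lt.ne' h1'

/-- On `E₁(u)` with `u² + 64` prime, the only rational `2`-torsion `x`-coordinate is `0`: the `2`-division cubic is
`x(4x² − ux − 4)` and `4x² − ux − 4 = 0` forces `(8x − u)² = u² + 64`, not a rational square.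
[cite: SteinWatkins2004, §1 (PDF p. 3)] [cite: Mazur1977, III §7 (p. 162)] -/
theorem eq_zero_of_hasRationalTwoTorsionX_neumannSetzerCurve₁ {N : ℕ} (hN : N.Prime) (hNu : (N : ℤ) = u ^ 2 + 64)
    {x : ℚ} (hx : HasRationalTwoTorsionX (neumannSetzerCurve₁ u) x) : x = 0 := by
  obtain ⟨y, hE, h2⟩ := hx
  have hcub := fourXCubed_add_eq_zero_of_twoTorsion hE h2
  obtain ⟨hb₂, hb₄, hb₆⟩ := b_neumannSetzerCurve₁ u
  rw [hb₂, hb₄, hb₆] at hcub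
  have hfac : x * (4 * x ^ 2 - u * x - 4) = 0 := by linear_combination hcub
  rcases mul_eq_zero.mp hfac with h0 | hq
  · exact h0
  · exfalso
    have hNQ : ((N : ℤ) : ℚ) = ((u ^ 2 + 64 : ℤ) : ℚ) := by rw [hNu]
    push_cast at hNQ
    refine not_sq_eq_prime hN (8 * x - u) ?_
    rw [show ((N : ℚ)) = (u : ℚ) ^ 2 + 64 from hNQ]
    linear_combination 16 * hq

/-- On `E₀(u)` the only real root of the `2`-division cubic `(4x − u)(x² + 4)` is `u/4`.
[cite: SteinWatkins2004, §1 (PDF p. 3)] -/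
theorem eq_of_twoDivisionCubic_neumannSetzerCurve₀_real {ρ : ℝ}
    (h : 4 * ρ ^ 3 + ((neumannSetzerCurve₀ u).b₂ : ℝ) * ρ ^ 2 + 2 * ((neumannSetzerCurve₀ u).b₄ : ℝ) * ρ +
      ((neumannSetzerCurve₀ u).b₆ : ℝ) = 0) : ρ = (u : ℝ) / 4 := by
  obtain ⟨hb₂, hb₄, hb₆⟩ := b_neumannSetzerCurve₀ u
  rw [hb₂, hb₄, hb₆] at h
  push_cast at h
  have hfac : (4 * ρ - u) * (ρ ^ 2 + 4) = 0 := by linear_combination h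
  have hpos : ρ ^ 2 + 4 ≠ 0 := by positivity
  rcases mul_eq_zero.mp hfac with h1 | h1
  · linarith
  · exact absurd h1 hpos

/-- On `E₀(u)` the only rational `2`-torsion `x`-coordinate is `u/4`. [cite: SteinWatkins2004, §1 (PDF p. 3)] -/
theorem eq_of_hasRationalTwoTorsionX_neumannSetzerCurve₀ {x : ℚ} (hx : HasRationalTwoTorsionX (neumannSetzerCurve₀ u) x) :
    x = (u : ℚ) / 4 := by
  obtain ⟨y, hE, h2⟩ := hx
  have h := eq_of_twoDivisionCubic_neumannSetzerCurve₀_real u (fourXCubed_add_eq_zero_of_twoTorsion_real hE h2)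
  have : ((x : ℚ) : ℝ) = (((u : ℚ) / 4 : ℚ) : ℝ) := by rw [h]; push_cast; ring
  exact_mod_cast this

/-- The point `(u/4, −u/8)` of `E₀(u)` is ODD: `u/4` is the least (indeed the only) real root of the `2`-division cubic.
[cite: GreenbergLNM1716, §5 (chunk p0168) (definition of "odd")] [cite: SteinWatkins2004, §1 (PDF p. 3)] -/
theorem twoTorsionOdd_neumannSetzerCurve₀ : TwoTorsionOdd (neumannSetzerCurve₀ u) ((u : ℚ) / 4) := by
  intro ρ hρ
  rw [eq_of_twoDivisionCubic_neumannSetzerCurve₀_real u hρ]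
  push_cast
  exact le_rfl

/-- The point `(0, 0)` of `E₁(u)` is NOT odd: `(u − √(u² + 64))/8` is a NEGATIVE real root of the `2`-division cubic
`x(4x² − ux − 4)`. [cite: GreenbergLNM1716, §5 (chunk p0168) (definition of "odd")] [cite: SteinWatkins2004, §1 (PDF p. 3)] -/
theorem not_twoTorsionOdd_neumannSetzerCurve₁ : ¬ TwoTorsionOdd (neumannSetzerCurve₁ u) 0 := by
  intro h
  obtain ⟨hb₂, hb₄, hb₆⟩ := b_neumannSetzerCurve₁ u
  set s : ℝ := Real.sqrt ((u : ℝ) ^ 2 + 64) with hs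
  have hs2 : s ^ 2 = (u : ℝ) ^ 2 + 64 := by
    rw [hs, Real.sq_sqrt (by positivity)]
  have hus : (u : ℝ) < s := by
    have h1 : Real.sqrt ((u : ℝ) ^ 2) < s := Real.sqrt_lt_sqrt (by positivity) (by linarith)
    rw [Real.sqrt_sq_eq_abs] at h1
    exact (le_abs_self _).trans_lt h1
  have hroot : 4 * (((u : ℝ) - s) / 8) ^ 3 + ((neumannSetzerCurve₁ u).b₂ : ℝ) * (((u : ℝ) - s) / 8) ^ 2 +
      2 * ((neumannSetzerCurve₁ u).b₄ : ℝ) * (((u : ℝ) - s) / 8) + ((neumannSetzerCurve₁ u).b₆ : ℝ) = 0 := by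
    rw [hb₂, hb₄, hb₆]
    push_cast
    linear_combination (((u : ℝ) - s) / 128) * hs2
  have hle := h _ hroot
  push_cast at hle
  linarith

/-- `(u + 1)/4` is an integer for `u ≡ 3 (mod 4)`. [cite: SteinWatkins2004, §1 (PDF p. 3, u ≡ 3 (mod 4))] -/
theorem exists_quarter_of_emod_four {u : ℤ} (hu : u % 4 = 3) : ∃ m : ℤ, (m : ℚ) = ((u : ℚ) + 1) / 4 ∧ 4 * m = u + 1 := by
  refine ⟨(u + 1) / 4, ?_, ?_⟩
  · have h : (4 : ℤ) ∣ u + 1 := by omega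
    rw [Int.cast_div h (by norm_num)]
    push_cast; ring
  · exact Int.mul_ediv_cancel' (by omega)

/-- `E₁(u)` written with integer-cast coefficients `[1, −m, 0, −1, 0]`, `4m = u + 1`. [cite: SteinWatkins2004, §1 eq. (1) (PDF p. 3)] -/
theorem neumannSetzerCurve₁_eq_intCast {m : ℤ} (hm : (m : ℚ) = ((u : ℚ) + 1) / 4) :
    neumannSetzerCurve₁ u = ⟨((1 : ℤ) : ℚ), ((-m : ℤ) : ℚ), ((0 : ℤ) : ℚ), ((-1 : ℤ) : ℚ), ((0 : ℤ) : ℚ)⟩ := by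
  simp only [neumannSetzerCurve₁, Int.cast_neg, hm, Int.cast_one, Int.cast_zero]

/-- `E₀(u)` written with integer-cast coefficients `[1, −m, 0, 4, −u]`, `4m = u + 1`. [cite: SteinWatkins2004, §1 eq. (1) (PDF p. 3)] -/
theorem neumannSetzerCurve₀_eq_intCast {m : ℤ} (hm : (m : ℚ) = ((u : ℚ) + 1) / 4) :
    neumannSetzerCurve₀ u = ⟨((1 : ℤ) : ℚ), ((-m : ℤ) : ℚ), ((0 : ℤ) : ℚ), ((4 : ℤ) : ℚ), ((-u : ℤ) : ℚ)⟩ := by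
  simp only [neumannSetzerCurve₀, Int.cast_neg, hm, Int.cast_one, Int.cast_zero, Int.cast_ofNat]

/-- `discOf [1, −m, 0, −1, 0] = (4m − 1)² + 64` (`= u² + 64` for `4m = u + 1`). [cite: SilvermanAEC2009, III §1 (Δ)] -/
theorem discOf_neumannSetzer₁ (m : ℤ) : discOf [1, -m, 0, -1, 0] = (4 * m - 1) ^ 2 + 64 := by
  simp only [discOf, invariants]
  ring

/-- `discOf [1, −m, 0, 4, −u] = −(u² + 64)²` for `4m = u + 1`. [cite: SilvermanAEC2009, III §1 (Δ)] -/
theorem discOf_neumannSetzer₀ (m : ℤ) (hm : 4 * m = u + 1) : discOf [1, -m, 0, 4, -u] = -(u ^ 2 + 64) ^ 2 := by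
  have hu : u = 4 * m - 1 := by linarith
  subst hu
  simp only [discOf, invariants]
  ring

/-- No prime `q` has `q¹² ∣ N` or `q¹² ∣ N²` when `N` is prime. [folklore] -/
theorem not_pow_twelve_dvd_sq_of_prime {N : ℕ} (hN : N.Prime) (q : ℕ) (hq : q.Prime) : ¬ (q : ℤ) ^ 12 ∣ (N : ℤ) ^ 2 := by
  intro h
  have hqN : (q : ℤ) ∣ (N : ℤ) ^ 2 := dvd_trans (dvd_pow_self _ (by norm_num)) h
  have hqN' : q ∣ N ^ 2 := by exact_mod_cast hqN
  have hqN'' : q ∣ N := hq.dvd_of_dvd_pow hqN'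
  have hqeq : q = N := (Nat.prime_dvd_prime_iff_eq hq hN).mp hqN''
  subst hqeq
  have h' : q ^ 12 ∣ q ^ 2 := by exact_mod_cast h
  have := Nat.pow_dvd_pow_iff_le_right hq.one_lt |>.mp h'
  omega

/-- **`E₁(u)` is a global minimal model** (`Δ = u² + 64` prime: no `q¹² ∣ Δ`).
[cite: SilvermanAEC2009, VII.1 Remark 1.1] [cite: SteinWatkins2004, §1 (PDF p. 3, "Δ = p")] -/
theorem isGloballyMinimal_neumannSetzerCurve₁ {N : ℕ} (hN : N.Prime) (hNu : (N : ℤ) = u ^ 2 + 64) (hu4 : u % 4 = 3) :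
    (neumannSetzerCurve₁ u).IsGloballyMinimal := by
  obtain ⟨m, hm, hm4⟩ := exists_quarter_of_emod_four hu4
  rw [neumannSetzerCurve₁_eq_intCast u hm]
  refine isGloballyMinimal_of_int_criterion 1 (-m) 0 (-1) 0 fun q hq hboth ↦ ?_
  obtain ⟨h12, -⟩ := hboth
  rw [discOf_neumannSetzer₁] at h12
  have hΔ : (4 * m - 1) ^ 2 + 64 = (N : ℤ) := by rw [show 4 * m - 1 = u by linarith, hNu]
  rw [hΔ] at h12
  exact not_pow_twelve_dvd_sq_of_prime hN q hq (dvd_trans h12 (dvd_pow_self _ (by norm_num)))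

/-- **`E₀(u)` is a global minimal model** (`Δ = −(u² + 64)²` with `u² + 64` prime: no `q¹² ∣ Δ`).
[cite: SilvermanAEC2009, VII.1 Remark 1.1] [cite: SteinWatkins2004, §1 (PDF p. 3, "Δ = −p²")] -/
theorem isGloballyMinimal_neumannSetzerCurve₀ {N : ℕ} (hN : N.Prime) (hNu : (N : ℤ) = u ^ 2 + 64) (hu4 : u % 4 = 3) :
    (neumannSetzerCurve₀ u).IsGloballyMinimal := by
  obtain ⟨m, hm, hm4⟩ := exists_quarter_of_emod_four hu4
  rw [neumannSetzerCurve₀_eq_intCast u hm]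
  refine isGloballyMinimal_of_int_criterion 1 (-m) 0 4 (-u) fun q hq hboth ↦ ?_
  obtain ⟨h12, -⟩ := hboth
  rw [discOf_neumannSetzer₀ u m hm4, ← hNu, dvd_neg] at h12
  exact not_pow_twelve_dvd_sq_of_prime hN q hq h12

end NeumannSetzer

end Summit.BirchSwinnertonDyer.BirchSwinnertonDyer.Theorems.DepletionAtTwo

end
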